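import Literature.AlgebraicGeometry.Resolution.CoordinateBlowupChart
import Literature.AlgebraicGeometry.Resolution.BlowupAlgebraStrictTransform
import Literature.RingTheory.MvPolynomial.VariableIdeals
import HarnessLib

/-!
# Proper transforms of polynomials under a coordinate blow-up (Hu 2025, §5 Def. 5.4, Lemma 5.5)

Topic: `Literature/AlgebraicGeometry/Resolution`. Continuation of `CoordinateBlowupChart.lean`
(the standard chart over `X_{i₀}` of the blow-up of `𝔸^σ_S` along `V(X_i : i ∈ A)` is `𝔸^σ_S`,
with blow-up map Hu's substitution `coordBlowupSubst : X_i ↦ X_{i₀} X_i` for `i ∈ A ∖ {i₀}`).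
Y. Hu, *Universal characteristic-free resolution of singularities, I* (arXiv:2507.21400), §5,
Definition 5.4, defines the **proper transform** of a binomial `B = T⁰ - T¹` in the variables
of the lower chart `𝔙'` on the chart `𝔙` over `ξ₀ ≡ 1`:

> "We let `m_{φ,Tⁱ} = Σ_{j=0}^m deg_{y'_j}(Tⁱ)`, `i = 0, 1`, `l_{φ,B} = min {m_{φ,T⁰}, m_{φ,T¹}}`.
> … we substitute `y'_i` by `y'₀ ξ_i`, for all `i ∈ [m]`, into `B_{𝔙'}` … to obtain the pullback
> `π*_{𝔙,𝔙'} B_{𝔙'}` … We then let `B_𝔙 = (π*_{𝔙,𝔙'} B_{𝔙'}) / ζ^{l_{φ,B_{𝔙'}}}`. We call `B_𝔙` …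
> the proper transform of `B_{𝔙'}`."

and Lemma 5.5: *"`y^b ∣ T_{𝔙,B}` if and only if `y'^b ∣ T_{𝔙',B}`"* for every variable
`y ≠ ζ`. This file PROVES the construction for ARBITRARY polynomials `f ∈ S[X_σ]` over any
commutative ring `S` (Hu applies it to binomials, and to general polynomials through the
"Γ-transforms" of §7), in the coordinates of `CoordinateBlowupChart.lean`
(`ζ = X_{i₀}`, `y_i = X_i`):

* `centreDegree A d` — Hu's `m_φ(T)`, the total degree of an exponent `d` in the centre
  variables `A` (a `Finsupp.weight`); `coordBlowupSubst_monomial`: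
  **`π*(c X^d) = ζ^{m_φ(d)} · c X^{d∖ζ}`**;
* `centreOrder A f` — Hu's `l_{φ,B}` for a general `f`: the least `m_φ` over the monomials of
  `f` (the order of `f` along the centre); `coordProperTransform S A i₀ f` — **the proper
  transform** `f_𝔙 := π*(f) / ζ^{l}`, given by the explicit exponent map `coordTransformExp`;
* `coordBlowupSubst_eq_X_pow_mul_coordProperTransform` — **`π* f = ζ^l · f_𝔙`** (Def. 5.4),
  `coordProperTransform_not_mem_span_X` — **`ζ ∤ f_𝔙`** for `f ≠ 0`, and the uniqueness of such a
  factorisation `eq_centreOrder_and_eq_coordProperTransform` (so `f_𝔙` does not depend on the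
  presentation of `f`);
* `coeff_coordTransformExp_coordProperTransform`, `coordTransformExp_apply_of_ne` — Lemma 5.5
  (the exponents of the variables `y ≠ ζ` are unchanged term by term);
* the cases Hu lists in Prop. 5.3 / Def. 5.4: `coordProperTransform_X_of_ne` (`= X_i` for
  `i ≠ i₀`), `coordProperTransform_X_self` (`= 1`: the hyperplane `y'₀ = 0 ⊇ Z` has empty proper
  transform on this chart), `coordProperTransform_C`, `coordProperTransform_monomial`, and
  **binomials** `centreOrder_monomial_sub_monomial`, `coordProperTransform_monomial_sub_monomial`
  (Def. 5.4 verbatim: `l = min {m₀, m₁}`, `B_𝔙 = a ζ^{m₀-l} T⁰' - b ζ^{m₁-l} T¹'`);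
* over a domain: `centreOrder_mul`, `coordProperTransform_mul` (proper transforms are
  multiplicative, orders additive);
* **geometric meaning** (Görtz–Wedhorn Prop. 13.96 (2) via `BlowupAlgebraStrictTransform.lean`):
  over a domain `S`, `X_{i₀}` is prime in `S[X_σ]` and in the chart ring `S[X_σ][I/X_{i₀}]`
  (`prime_algebraMap_X_blowupAlgebra`), the equation `f` factors there as
  `X_{i₀}^l · (chart iso of f_𝔙)` (`algebraMap_eq_pow_mul_coordBlowupChartEquiv_coordProperTransform`),
  hence the kernel of `S[X_σ][I/X_{i₀}] → (S[X_σ]/(f))[Ī/X̄_{i₀}]` is `(f_𝔙)`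
  (`ker_mapQuotient_eq_span_coordProperTransform`) and **the chart over `X_{i₀}` of the blow-up
  of the hypersurface `V(f) ⊂ 𝔸^σ_S` along `V(X_i : i ∈ A)` is `Spec S[X_σ]/(f_𝔙)`**
  (`quotientCoordProperTransformEquiv`, `_mk`) — Hu's use of `B_𝔙` as the local equation of the
  proper transform of `(B = 0)`.

No named facts; everything is proved (D-0026). For a closed subscheme of higher codimension the
ideal of the proper (strict) transform is the `ζ`-saturation of the transformed ideal and is in
general NOT generated by the proper transforms of generators — which is why Hu carries extra
relations and closes with a Jacobian argument (§8); nothing of that is claimed here.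

## References

* Y. Hu, *Universal Characteristic-free Resolution of Singularities, I*, arXiv:2507.21400 (2025),
  §5, Def. 5.2, Prop. 5.3, Def. 5.4, Lemma 5.5 (theorem numbers of the arXiv v1 TeX source). [Hu2025]
* U. Görtz, T. Wedhorn, *Algebraic Geometry I*, 2nd ed. (2020), Prop. 13.96 (2) and p. 416
  (strict transform of a closed subscheme on the charts `A[I/f]`). [GortzWedhorn2020]
* The Stacks Project, Tag 080C (strict transform), Tag 0804 (charts of a blowing up). [StacksProject]
-/

noncomputable section

open MvPolynomial IsLocalization

namespace Literature.AlgebraicGeometry.Resolution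

universe u v

variable (S : Type u) [CommRing S] {σ : Type v} (A : Set σ) (i₀ : σ)

/-! ### Hu's `m_φ`: the degree of a monomial in the centre variables -/

open Classical in
/-- Weight `1` on the centre variables `A`, `0` elsewhere. [folklore] -/
def centreWeight (A : Set σ) : σ → ℕ := fun i => if i ∈ A then 1 else 0

/-- `centreWeight A i = 1` for `i ∈ A`. [folklore] -/
theorem centreWeight_of_mem {i : σ} (hi : i ∈ A) : centreWeight A i = 1 := by
  classical
  exact if_pos hi

/-- `centreWeight A i = 0` for `i ∉ A`. [folklore] -/
theorem centreWeight_of_not_mem {i : σ} (hi : i ∉ A) : centreWeight A i = 0 := by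
  classical
  exact if_neg hi

/-- **Hu's `m_φ(T)`**: the total degree `Σ_{i ∈ A} d_i` of the exponent `d` in the centre
variables (Def. 5.4: `m_{φ,T} = Σ_j deg_{y'_j} T`). [cite: Hu2025, §5 Def. 5.4] -/
def centreDegree (A : Set σ) (d : σ →₀ ℕ) : ℕ := Finsupp.weight (centreWeight A) d

/-- `m_φ` is additive. [folklore] -/
theorem centreDegree_add (d e : σ →₀ ℕ) :
    centreDegree A (d + e) = centreDegree A d + centreDegree A e := by
  simp [centreDegree]

/-- `m_φ(1) = 0`. [folklore] -/
@[simp] theorem centreDegree_zero : centreDegree A (0 : σ →₀ ℕ) = 0 := by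
  simp [centreDegree]

/-- `m_φ(X_i^k) = k` for a centre variable. [folklore] -/
theorem centreDegree_single_of_mem {i : σ} (hi : i ∈ A) (k : ℕ) :
    centreDegree A (Finsupp.single i k) = k := by
  rw [centreDegree, Finsupp.weight_single, centreWeight_of_mem A hi, smul_eq_mul, mul_one]

/-- `m_φ(X_i^k) = 0` off the centre variables. [folklore] -/
theorem centreDegree_single_of_not_mem {i : σ} (hi : i ∉ A) (k : ℕ) :
    centreDegree A (Finsupp.single i k) = 0 := by
  rw [centreDegree, Finsupp.weight_single, centreWeight_of_not_mem A hi, smul_eq_mul, mul_zero]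

/-- `m_φ(d) = m_φ(d ∖ ζ) + d_ζ` for `ζ = X_{i₀}`, `i₀ ∈ A`. [folklore] -/
theorem centreDegree_eq_erase_add (hi₀ : i₀ ∈ A) (d : σ →₀ ℕ) :
    centreDegree A d = centreDegree A (d.erase i₀) + d i₀ := by
  conv_lhs => rw [← Finsupp.erase_add_single i₀ d]
  rw [centreDegree_add, centreDegree_single_of_mem A hi₀]

/-- **The pullback of a monomial** (Hu Prop. 5.3 / Def. 5.4: substitute `y'_i = ζ ξ_i`):
`π*(c X^d) = ζ^{m_φ(d)} · c X^{d ∖ ζ}`, where `d ∖ ζ` is `d` with the `ζ = X_{i₀}` exponent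
removed. [cite: Hu2025, §5 Def. 5.4] -/
theorem coordBlowupSubst_monomial (hi₀ : i₀ ∈ A) (d : σ →₀ ℕ) (c : S) :
    coordBlowupSubst S A i₀ (monomial d c) =
      X i₀ ^ centreDegree A d * monomial (d.erase i₀) c := by
  classical
  induction d using Finsupp.induction with
  | zero =>
    simp only [centreDegree_zero, pow_zero, one_mul, Finsupp.erase_zero]
    exact coordBlowupSubst_C S A i₀ c
  | single_add i k d hid hk ih =>
    rw [monomial_single_add, map_mul, map_pow, ih, centreDegree_add, Finsupp.erase_add, pow_add]
    by_cases hiA : i ∈ A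
    · by_cases hne : i = i₀
      · subst hne
        rw [coordBlowupSubst_X_self, centreDegree_single_of_mem A hiA, Finsupp.erase_single,
          zero_add]
        ring
      · rw [coordBlowupSubst_X_of_mem_of_ne S A i₀ hiA hne, centreDegree_single_of_mem A hiA,
          Finsupp.erase_single_ne (Ne.symm hne), monomial_single_add]
        ring
    · have hne : i ≠ i₀ := fun h => hiA (h ▸ hi₀)
      rw [coordBlowupSubst_X_of_not_mem S A i₀ hiA, centreDegree_single_of_not_mem A hiA,
        Finsupp.erase_single_ne (Ne.symm hne), pow_zero, one_mul, monomial_single_add]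
      ring

/-! ### Hu's `l_{φ,B}`: the order of a polynomial along the centre -/

variable {S} in
open Classical in
/-- **Hu's `l_{φ,B}`** for a general polynomial: the least degree in the centre variables of a
monomial of `f` (`0` for `f = 0`); for a binomial `B = T⁰ - T¹` this is
`min {m_{φ,T⁰}, m_{φ,T¹}}` (Def. 5.4). [cite: Hu2025, §5 Def. 5.4] -/
def centreOrder (f : MvPolynomial σ S) : ℕ :=
  if h : f.support.Nonempty then (f.support.image (centreDegree A)).min' (h.image _) else 0

/-- `l = 0` for the zero polynomial (convention). [folklore] -/
@[simp] theorem centreOrder_zero : centreOrder A (0 : MvPolynomial σ S) = 0 := by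
  rw [centreOrder, dif_neg]
  simp

/-- `l ≤ m_φ(d)` for every monomial `d` of `f`. [cite: Hu2025, §5 Def. 5.4] -/
theorem centreOrder_le {f : MvPolynomial σ S} {d : σ →₀ ℕ} (hd : d ∈ f.support) :
    centreOrder A f ≤ centreDegree A d := by
  classical
  rw [centreOrder, dif_pos ⟨d, hd⟩]
  convert Finset.min'_le _ _ (Finset.mem_image_of_mem (centreDegree A) hd)

/-- The order is attained: some monomial of `f ≠ 0` has `m_φ = l`. [cite: Hu2025, §5 Def. 5.4] -/
theorem exists_centreDegree_eq_centreOrder {f : MvPolynomial σ S} (hf : f ≠ 0) :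
    ∃ d ∈ f.support, centreDegree A d = centreOrder A f := by
  classical
  have h : f.support.Nonempty := support_nonempty.mpr hf
  rw [centreOrder, dif_pos h]
  obtain ⟨d, hd, hdeq⟩ := Finset.mem_image.mp (Finset.min'_mem (f.support.image (centreDegree A))
    (h.image _))
  exact ⟨d, hd, by convert hdeq⟩

/-- A lower bound for all monomials is a lower bound for the order. [folklore] -/
theorem le_centreOrder {f : MvPolynomial σ S} (hf : f ≠ 0) {k : ℕ}
    (h : ∀ d ∈ f.support, k ≤ centreDegree A d) : k ≤ centreOrder A f := by
  obtain ⟨d, hd, hdeq⟩ := exists_centreDegree_eq_centreOrder S A hf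
  exact hdeq ▸ h d hd

/-- The order of a monomial term is its centre degree. [folklore] -/
theorem centreOrder_monomial (d : σ →₀ ℕ) {c : S} (hc : c ≠ 0) :
    centreOrder A (monomial d c) = centreDegree A d := by
  classical
  have hsupp : (monomial d c).support = {d} := by
    rw [support_monomial, if_neg hc]
  apply le_antisymm
  · exact centreOrder_le S A (by rw [hsupp]; exact Finset.mem_singleton_self d)
  · refine le_centreOrder S A (monomial_eq_zero.not.mpr hc) fun e he => ?_
    rw [hsupp, Finset.mem_singleton] at he
    rw [he]

/-! ### The proper transform (Hu Def. 5.4) -/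

/-- The exponent of the term of the proper transform coming from the term `X^d`:
`d ∖ ζ + (m_φ(d) - l) · ζ` (divide `π*(X^d) = ζ^{m_φ(d)} X^{d ∖ ζ}` by `ζ^l`).
[cite: Hu2025, §5 Def. 5.4] -/
def coordTransformExp (A : Set σ) (i₀ : σ) (l : ℕ) (d : σ →₀ ℕ) : σ →₀ ℕ :=
  d.erase i₀ + Finsupp.single i₀ (centreDegree A d - l)

/-- **Lemma 5.5** (exponents of the variables `y ≠ ζ` are unchanged): the transformed exponent
agrees with `d` off `i₀` — "`y^b ∣ T_{𝔙,B}` if and only if `y'^b ∣ T_{𝔙',B}`".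
[cite: Hu2025, §5 Lemma 5.5] -/
theorem coordTransformExp_apply_of_ne (l : ℕ) (d : σ →₀ ℕ) {j : σ} (hj : j ≠ i₀) :
    coordTransformExp A i₀ l d j = d j := by
  classical
  simp [coordTransformExp, Finsupp.erase_ne hj, Ne.symm hj]

/-- The `ζ`-exponent of the transformed exponent is `m_φ(d) - l`. [cite: Hu2025, §5 Def. 5.4] -/
theorem coordTransformExp_apply_self (l : ℕ) (d : σ →₀ ℕ) :
    coordTransformExp A i₀ l d i₀ = centreDegree A d - l := by
  classical
  simp [coordTransformExp]

/-- The transformed exponents of distinct terms of order `≥ l` are distinct (`i₀ ∈ A`): the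
term `X^d` is recovered from `d ∖ ζ` and `m_φ(d)`. [folklore] -/
theorem coordTransformExp_injective_of_le (hi₀ : i₀ ∈ A) (l : ℕ) {d e : σ →₀ ℕ}
    (hd : l ≤ centreDegree A d) (he : l ≤ centreDegree A e)
    (h : coordTransformExp A i₀ l d = coordTransformExp A i₀ l e) : d = e := by
  have herase : d.erase i₀ = e.erase i₀ := by
    ext j
    by_cases hj : j = i₀
    · subst hj
      simp
    · have h' := DFunLike.congr_fun h j
      rw [coordTransformExp_apply_of_ne A i₀ l d hj, coordTransformExp_apply_of_ne A i₀ l e hj] at h'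
      rwa [Finsupp.erase_ne hj, Finsupp.erase_ne hj]
  have hdeg : centreDegree A d = centreDegree A e := by
    have h' := DFunLike.congr_fun h i₀
    rw [coordTransformExp_apply_self, coordTransformExp_apply_self] at h'
    omega
  have hi : d i₀ = e i₀ := by
    have h1 := centreDegree_eq_erase_add A i₀ hi₀ d
    have h2 := centreDegree_eq_erase_add A i₀ hi₀ e
    rw [herase] at h1
    omega
  rw [← Finsupp.erase_add_single i₀ d, ← Finsupp.erase_add_single i₀ e, herase, hi]

/-- **The proper transform `f_𝔙 = π*(f) / ζ^{l}`** of a polynomial `f` of the lower chart under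
the coordinate blow-up `X_i ↦ X_{i₀} X_i` (`i ∈ A ∖ {i₀}`), term by term
(Hu Def. 5.4, stated there for binomials `B_𝔙 = (π* B_{𝔙'}) / ζ^{l_{φ,B}}`).
[cite: Hu2025, §5 Def. 5.4] -/
def coordProperTransform (f : MvPolynomial σ S) : MvPolynomial σ S :=
  ∑ d ∈ f.support, monomial (coordTransformExp A i₀ (centreOrder A f) d) (coeff d f)

/-- The proper transform of `0` is `0`. [folklore] -/
@[simp] theorem coordProperTransform_zero :
    coordProperTransform S A i₀ (0 : MvPolynomial σ S) = 0 := by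
  simp [coordProperTransform]

/-- **Def. 5.4: `π* f = ζ^{l} · f_𝔙`** — the pullback of `f` under the blow-up substitution is
`ζ^{l}` times the proper transform. [cite: Hu2025, §5 Def. 5.4] -/
theorem coordBlowupSubst_eq_X_pow_mul_coordProperTransform (hi₀ : i₀ ∈ A)
    (f : MvPolynomial σ S) :
    coordBlowupSubst S A i₀ f =
      X i₀ ^ centreOrder A f * coordProperTransform S A i₀ f := by
  conv_lhs => rw [f.as_sum]
  rw [map_sum, coordProperTransform, Finset.mul_sum]
  refine Finset.sum_congr rfl fun d hd => ?_
  obtain ⟨n, hn⟩ := Nat.exists_eq_add_of_le (centreOrder_le S A hd)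
  rw [coordBlowupSubst_monomial S A i₀ hi₀, coordTransformExp, hn, Nat.add_sub_cancel_left, pow_add,
    monomial_add_single]
  ring

/-- The coefficient of the transformed term: `f_𝔙` has the coefficient of `X^d` in `f` at the
transformed exponent of `d`. [cite: Hu2025, §5 Def. 5.4] -/
theorem coeff_coordTransformExp_coordProperTransform (hi₀ : i₀ ∈ A) {f : MvPolynomial σ S}
    {d : σ →₀ ℕ} (hd : d ∈ f.support) :
    coeff (coordTransformExp A i₀ (centreOrder A f) d) (coordProperTransform S A i₀ f) =
      coeff d f := by
  classical
  rw [coordProperTransform, coeff_sum, Finset.sum_eq_single d]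
  · rw [coeff_monomial, if_pos rfl]
  · intro e he hne
    rw [coeff_monomial, if_neg]
    intro h
    exact hne (coordTransformExp_injective_of_le A i₀ hi₀ _ (centreOrder_le S A he)
      (centreOrder_le S A hd) h)
  · intro h
    exact absurd hd h

/-- Coefficients of `f_𝔙` at exponents not of the transformed form vanish. [folklore] -/
theorem coeff_coordProperTransform_eq_zero {f : MvPolynomial σ S} {m : σ →₀ ℕ}
    (hm : ∀ d ∈ f.support, coordTransformExp A i₀ (centreOrder A f) d ≠ m) :
    coeff m (coordProperTransform S A i₀ f) = 0 := by
  classical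
  rw [coordProperTransform, coeff_sum]
  exact Finset.sum_eq_zero fun d hd => by rw [coeff_monomial, if_neg (hm d hd)]

open Classical in
/-- **The monomials of `f_𝔙` are the transformed monomials of `f`** (no cancellation; Lemma 5.5
in support form). [cite: Hu2025, §5 Lemma 5.5] -/
theorem support_coordProperTransform (hi₀ : i₀ ∈ A) (f : MvPolynomial σ S) :
    (coordProperTransform S A i₀ f).support =
      f.support.image (coordTransformExp A i₀ (centreOrder A f)) := by
  classical
  ext m
  rw [mem_support_iff, Finset.mem_image]
  constructor
  · intro h
    by_contra hne
    push Not at hne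
    exact h (coeff_coordProperTransform_eq_zero S A i₀ hne)
  · rintro ⟨d, hd, rfl⟩
    rw [coeff_coordTransformExp_coordProperTransform S A i₀ hi₀ hd]
    exact mem_support_iff.mp hd

/-- **`ζ ∤ f_𝔙`**: the proper transform of `f ≠ 0` does not lie in `(X_{i₀})` — the term of
`f` of least centre degree becomes a term free of `ζ`. [cite: Hu2025, §5 Def. 5.4] -/
theorem coordProperTransform_not_mem_span_X (hi₀ : i₀ ∈ A) {f : MvPolynomial σ S} (hf : f ≠ 0) :
    coordProperTransform S A i₀ f ∉ Ideal.span {(X i₀ : MvPolynomial σ S)} := by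
  obtain ⟨d, hd, hdeq⟩ := exists_centreDegree_eq_centreOrder S A hf
  intro hmem
  rw [← Set.image_singleton, mem_ideal_span_X_image] at hmem
  have hsupp : coordTransformExp A i₀ (centreOrder A f) d ∈
      (coordProperTransform S A i₀ f).support := by
    rw [mem_support_iff, coeff_coordTransformExp_coordProperTransform S A i₀ hi₀ hd]
    exact mem_support_iff.mp hd
  obtain ⟨i, hi, hne⟩ := hmem _ hsupp
  rw [Set.mem_singleton_iff] at hi
  subst hi
  apply hne
  rw [coordTransformExp_apply_self, hdeq, Nat.sub_self]

/-- The proper transform of `f ≠ 0` is non-zero. [folklore] -/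
theorem coordProperTransform_ne_zero (hi₀ : i₀ ∈ A) {f : MvPolynomial σ S} (hf : f ≠ 0) :
    coordProperTransform S A i₀ f ≠ 0 := fun h =>
  coordProperTransform_not_mem_span_X S A i₀ hi₀ hf (h ▸ Ideal.zero_mem _)

/-! ### Uniqueness of the factorisation `π* f = ζ^l · f_𝔙` -/

/-- In `S[X_σ]`: if `ζ^k g = ζ^{k'} g'` with `k ≤ k'` and `ζ ∤ g` then `k = k'` and `g = g'`
(`ζ = X_{i₀}` is a non-zero-divisor). [folklore] -/
theorem eq_of_X_pow_mul_eq_of_le {k k' : ℕ} {g g' : MvPolynomial σ S} (hle : k ≤ k')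
    (hg : g ∉ Ideal.span {(X i₀ : MvPolynomial σ S)})
    (h : X i₀ ^ k * g = X i₀ ^ k' * g') : k = k' ∧ g = g' := by
  obtain ⟨n, rfl⟩ := Nat.exists_eq_add_of_le hle
  rw [pow_add, mul_assoc] at h
  have h' : g = X i₀ ^ n * g' := ((MvPolynomial.isRegular_X (R := S) (n := i₀)).pow k).left h
  cases n with
  | zero =>
    rw [pow_zero, one_mul] at h'
    exact ⟨(add_zero k).symm, h'⟩
  | succ n =>
    exfalso
    apply hg
    rw [h', pow_succ]
    exact Ideal.mul_mem_right _ _ (Ideal.mul_mem_left _ _ (Ideal.subset_span rfl))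

/-- In `S[X_σ]`: if `ζ^k g = ζ^{k'} g'` with `ζ ∤ g`, `ζ ∤ g'` then `k = k'` and `g = g'`.
[folklore] -/
theorem eq_of_X_pow_mul_eq {k k' : ℕ} {g g' : MvPolynomial σ S}
    (hg : g ∉ Ideal.span {(X i₀ : MvPolynomial σ S)})
    (hg' : g' ∉ Ideal.span {(X i₀ : MvPolynomial σ S)})
    (h : X i₀ ^ k * g = X i₀ ^ k' * g') : k = k' ∧ g = g' := by
  rcases le_total k k' with hle | hle
  · exact eq_of_X_pow_mul_eq_of_le S i₀ hle hg h
  · obtain ⟨h1, h2⟩ := eq_of_X_pow_mul_eq_of_le S i₀ hle hg' h.symm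
    exact ⟨h1.symm, h2.symm⟩

/-- **Uniqueness of the proper transform**: any factorisation `π* f = ζ^k · g` with `ζ ∤ g` of
the pullback of `f ≠ 0` has `k = l` and `g = f_𝔙` (so Def. 5.4 does not depend on how `f` is
written). [cite: Hu2025, §5 Def. 5.4] -/
theorem eq_centreOrder_and_eq_coordProperTransform (hi₀ : i₀ ∈ A) {f : MvPolynomial σ S}
    (hf : f ≠ 0) {k : ℕ} {g : MvPolynomial σ S}
    (hg : g ∉ Ideal.span {(X i₀ : MvPolynomial σ S)})
    (h : coordBlowupSubst S A i₀ f = X i₀ ^ k * g) :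
    k = centreOrder A f ∧ g = coordProperTransform S A i₀ f := by
  rw [coordBlowupSubst_eq_X_pow_mul_coordProperTransform S A i₀ hi₀] at h
  exact eq_of_X_pow_mul_eq S i₀ hg (coordProperTransform_not_mem_span_X S A i₀ hi₀ hf) h.symm

/-! ### Monomials, variables, constants, binomials (Prop. 5.3, Def. 5.4) -/

/-- The proper transform of a monomial term `c X^d` is `c X^{d ∖ ζ}` (all of `ζ^{m_φ(d)}` is
divided out). [cite: Hu2025, §5 Def. 5.4] -/
theorem coordProperTransform_monomial (d : σ →₀ ℕ) (c : S) :
    coordProperTransform S A i₀ (monomial d c) = monomial (d.erase i₀) c := by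
  classical
  by_cases hc : c = 0
  · subst hc
    simp
  · rw [coordProperTransform, support_monomial, if_neg hc, Finset.sum_singleton,
      centreOrder_monomial S A d hc, coordTransformExp, Nat.sub_self, Finsupp.single_zero, add_zero,
      coeff_monomial, if_pos rfl]

/-- **Prop. 5.3, second bullet**: the new free variable `y_i = X_i` (`i ≠ i₀`) is the proper
transform of `y'_i` — `(X_i)_𝔙 = X_i`. [cite: Hu2025, §5 Prop. 5.3] -/
theorem coordProperTransform_X_of_ne {i : σ} (hne : i ≠ i₀) :
    coordProperTransform S A i₀ (X i : MvPolynomial σ S) = X i := by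
  rw [X, coordProperTransform_monomial, Finsupp.erase_single_ne (Ne.symm hne)]

/-- The hyperplane `(y'₀ = 0) ⊇ Z` has EMPTY proper transform on the chart over `ξ₀ ≡ 1`:
`(X_{i₀})_𝔙 = 1` (its pullback `ζ` is all exceptional). [cite: Hu2025, §5 Prop. 5.3] -/
theorem coordProperTransform_X_self :
    coordProperTransform S A i₀ (X i₀ : MvPolynomial σ S) = 1 := by
  rw [X, coordProperTransform_monomial, Finsupp.erase_single]
  rfl

/-- Constants are their own proper transforms. [folklore] -/
theorem coordProperTransform_C (c : S) :
    coordProperTransform S A i₀ (C c : MvPolynomial σ S) = C c := by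
  rw [← monomial_zero', coordProperTransform_monomial, Finsupp.erase_zero]

open Classical in
/-- The support of a binomial `a X^d - b X^e` (`d ≠ e`, `a, b ≠ 0`). [folklore] -/
theorem support_monomial_sub_monomial {d e : σ →₀ ℕ} (hde : d ≠ e) {a b : S} (ha : a ≠ 0)
    (hb : b ≠ 0) : (monomial d a - monomial e b).support = {d, e} := by
  ext m
  rw [mem_support_iff, coeff_sub, coeff_monomial, coeff_monomial, Finset.mem_insert,
    Finset.mem_singleton]
  by_cases hmd : d = m
  · subst hmd
    rw [if_pos rfl, if_neg (Ne.symm hde), sub_zero]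
    exact ⟨fun _ => Or.inl rfl, fun _ => ha⟩
  · rw [if_neg hmd]
    by_cases hme : e = m
    · subst hme
      rw [if_pos rfl, zero_sub, neg_ne_zero]
      exact ⟨fun _ => Or.inr rfl, fun _ => hb⟩
    · rw [if_neg hme, sub_zero]
      refine ⟨fun h => absurd rfl h, fun h => ?_⟩
      rcases h with h | h
      · exact absurd h.symm hmd
      · exact absurd h.symm hme

/-- **Def. 5.4, `l_{φ,B} = min {m_{φ,T⁰}, m_{φ,T¹}}`** for a binomial `B = a T⁰ - b T¹`.
[cite: Hu2025, §5 Def. 5.4] -/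
theorem centreOrder_monomial_sub_monomial {d e : σ →₀ ℕ} (hde : d ≠ e) {a b : S} (ha : a ≠ 0)
    (hb : b ≠ 0) :
    centreOrder A (monomial d a - monomial e b) = min (centreDegree A d) (centreDegree A e) := by
  classical
  have hsupp := support_monomial_sub_monomial S hde ha hb
  have hne : monomial d a - monomial e b ≠ 0 := by
    intro h
    have := congrArg MvPolynomial.support h
    rw [hsupp, support_zero] at this
    exact Finset.insert_ne_empty _ _ this
  have hd : d ∈ (monomial d a - monomial e b).support := by
    rw [hsupp]
    exact Finset.mem_insert_self _ _
  have he : e ∈ (monomial d a - monomial e b).support := by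
    rw [hsupp]
    exact Finset.mem_insert_of_mem (Finset.mem_singleton_self _)
  apply le_antisymm
  · rcases le_total (centreDegree A d) (centreDegree A e) with h | h
    · rw [min_eq_left h]
      exact centreOrder_le S A hd
    · rw [min_eq_right h]
      exact centreOrder_le S A he
  · refine le_centreOrder S A hne fun m hm => ?_
    rw [hsupp, Finset.mem_insert, Finset.mem_singleton] at hm
    rcases hm with rfl | rfl
    · exact min_le_left _ _
    · exact min_le_right _ _

/-- **Def. 5.4 verbatim for a binomial `B = a T⁰ - b T¹`**:
`B_𝔙 = a ζ^{m₀ - l} T⁰' - b ζ^{m₁ - l} T¹'`, with `m_i = m_φ(Tⁱ)`, `l = min {m₀, m₁}` and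
`Tⁱ'` the term `Tⁱ` with `ζ` removed (so at least one of the two terms of `B_𝔙` is free of the
exceptional parameter). [cite: Hu2025, §5 Def. 5.4] -/
theorem coordProperTransform_monomial_sub_monomial {d e : σ →₀ ℕ} (hde : d ≠ e)
    {a b : S} (ha : a ≠ 0) (hb : b ≠ 0) :
    coordProperTransform S A i₀ (monomial d a - monomial e b) =
      X i₀ ^ (centreDegree A d - min (centreDegree A d) (centreDegree A e)) *
          monomial (d.erase i₀) a -
        X i₀ ^ (centreDegree A e - min (centreDegree A d) (centreDegree A e)) *
          monomial (e.erase i₀) b := by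
  classical
  have hsupp := support_monomial_sub_monomial S hde ha hb
  rw [coordProperTransform, centreOrder_monomial_sub_monomial S A hde ha hb, hsupp,
    Finset.sum_pair hde, coeff_sub, coeff_sub, coeff_monomial, coeff_monomial, coeff_monomial,
    coeff_monomial, if_pos rfl, if_neg (Ne.symm hde), if_neg hde, if_pos rfl, sub_zero, zero_sub,
    coordTransformExp, coordTransformExp, monomial_add_single, monomial_add_single, map_neg,
    sub_eq_add_neg]
  ring

/-! ### Over a domain: orders add, proper transforms multiply -/

section Domain

variable [IsDomain S]

/-- `(X_{i₀})` is a prime ideal of `S[X_σ]` for a domain `S`. [folklore] -/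
theorem isPrime_span_X_self : (Ideal.span {(X i₀ : MvPolynomial σ S)}).IsPrime := by
  have h := Literature.RingTheory.MvPolynomial.isPrime_span_X_image (R := S) ({i₀} : Set σ)
  rwa [Set.image_singleton] at h

/-- `X_{i₀}` is a prime element of `S[X_σ]` for a domain `S`. [folklore] -/
theorem prime_X_of_isDomain : Prime (X i₀ : MvPolynomial σ S) :=
  (Ideal.span_singleton_prime (X_ne_zero i₀)).mp (isPrime_span_X_self S i₀)

/-- **Orders along the centre add** for `f, g ≠ 0` over a domain. [folklore] -/
theorem centreOrder_mul (hi₀ : i₀ ∈ A) {f g : MvPolynomial σ S} (hf : f ≠ 0) (hg : g ≠ 0) :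
    centreOrder A (f * g) = centreOrder A f + centreOrder A g := by
  have hprod : coordProperTransform S A i₀ f * coordProperTransform S A i₀ g ∉
      Ideal.span {(X i₀ : MvPolynomial σ S)} := fun h =>
    ((isPrime_span_X_self S i₀).mem_or_mem h).elim
      (coordProperTransform_not_mem_span_X S A i₀ hi₀ hf)
      (coordProperTransform_not_mem_span_X S A i₀ hi₀ hg)
  have h : coordBlowupSubst S A i₀ (f * g) = X i₀ ^ (centreOrder A f + centreOrder A g) *
      (coordProperTransform S A i₀ f * coordProperTransform S A i₀ g) := by
    rw [map_mul, coordBlowupSubst_eq_X_pow_mul_coordProperTransform S A i₀ hi₀ f,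
      coordBlowupSubst_eq_X_pow_mul_coordProperTransform S A i₀ hi₀ g, pow_add]
    ring
  exact (eq_centreOrder_and_eq_coordProperTransform S A i₀ hi₀ (mul_ne_zero hf hg) hprod h).1.symm

/-- **Proper transforms are multiplicative** over a domain: `(f g)_𝔙 = f_𝔙 g_𝔙`. [folklore] -/
theorem coordProperTransform_mul (hi₀ : i₀ ∈ A) (f g : MvPolynomial σ S) :
    coordProperTransform S A i₀ (f * g) =
      coordProperTransform S A i₀ f * coordProperTransform S A i₀ g := by
  by_cases hf : f = 0
  · subst hf
    simp
  by_cases hg : g = 0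
  · subst hg
    simp
  have hprod : coordProperTransform S A i₀ f * coordProperTransform S A i₀ g ∉
      Ideal.span {(X i₀ : MvPolynomial σ S)} := fun h =>
    ((isPrime_span_X_self S i₀).mem_or_mem h).elim
      (coordProperTransform_not_mem_span_X S A i₀ hi₀ hf)
      (coordProperTransform_not_mem_span_X S A i₀ hi₀ hg)
  have h : coordBlowupSubst S A i₀ (f * g) = X i₀ ^ (centreOrder A f + centreOrder A g) *
      (coordProperTransform S A i₀ f * coordProperTransform S A i₀ g) := by
    rw [map_mul, coordBlowupSubst_eq_X_pow_mul_coordProperTransform S A i₀ hi₀ f,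
      coordBlowupSubst_eq_X_pow_mul_coordProperTransform S A i₀ hi₀ g, pow_add]
    ring
  exact (eq_centreOrder_and_eq_coordProperTransform S A i₀ hi₀ (mul_ne_zero hf hg) hprod h).2.symm

end Domain

/-! ### Geometric meaning: the chart of the blow-up of the hypersurface `V(f)` is `V(f_𝔙)` -/

/-- Under the chart isomorphism `S[X_σ] ≅ S[X_σ][I/X_{i₀}]` the variable `ζ = X_{i₀}` goes to
the structure-map image of `X_{i₀}` (the exceptional equation). [cite: Hu2025, §5 Prop. 5.3] -/
theorem coordBlowupChartEquiv_X_self :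
    coordBlowupChartEquiv S A i₀ (X i₀) =
      algebraMap (MvPolynomial σ S)
        (blowupAlgebra (Ideal.span (X '' A)) (X i₀ : MvPolynomial σ S)) (X i₀) := by
  have h := coordBlowupChartEquiv_coordBlowupSubst S A i₀ (X i₀)
  rwa [coordBlowupSubst_X_self] at h

/-- **`f = X_{i₀}^l · f_𝔙` in the chart ring `S[X_σ][I/X_{i₀}]`** (read through the chart
isomorphism): the hypothesis `hf` of `blowupAlgebra.ker_mapQuotient_eq_span`.
[cite: Hu2025, §5 Def. 5.4] [cite: GortzWedhorn2020, Prop. 13.96 (2) and p. 416] -/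
theorem algebraMap_eq_pow_mul_coordBlowupChartEquiv_coordProperTransform (hi₀ : i₀ ∈ A)
    (f : MvPolynomial σ S) :
    algebraMap (MvPolynomial σ S)
        (blowupAlgebra (Ideal.span (X '' A)) (X i₀ : MvPolynomial σ S)) f =
      algebraMap (MvPolynomial σ S)
          (blowupAlgebra (Ideal.span (X '' A)) (X i₀ : MvPolynomial σ S)) (X i₀) ^
            centreOrder A f *
        coordBlowupChartEquiv S A i₀ (coordProperTransform S A i₀ f) := by
  rw [← coordBlowupChartEquiv_coordBlowupSubst,
    coordBlowupSubst_eq_X_pow_mul_coordProperTransform S A i₀ hi₀, map_mul, map_pow,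
    coordBlowupChartEquiv_X_self]

/-- **`X_{i₀} ∤ f_𝔙` in the chart ring** (for `f ≠ 0`): the hypothesis `hndvd` of
`blowupAlgebra.ker_mapQuotient_eq_span`. [cite: Hu2025, §5 Def. 5.4] -/
theorem not_dvd_coordBlowupChartEquiv_coordProperTransform (hi₀ : i₀ ∈ A)
    {f : MvPolynomial σ S} (hf : f ≠ 0) :
    ¬ algebraMap (MvPolynomial σ S)
        (blowupAlgebra (Ideal.span (X '' A)) (X i₀ : MvPolynomial σ S)) (X i₀) ∣
      coordBlowupChartEquiv S A i₀ (coordProperTransform S A i₀ f) := by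
  rw [← coordBlowupChartEquiv_X_self, map_dvd_iff, ← Ideal.mem_span_singleton]
  exact coordProperTransform_not_mem_span_X S A i₀ hi₀ hf

variable [IsDomain S]

/-- **The exceptional equation `X_{i₀}` is prime in the chart ring `S[X_σ][I/X_{i₀}] ≅ S[X_σ]`**
(for a domain `S`): the hypothesis `hprime` of `blowupAlgebra.ker_mapQuotient_eq_span`.
[folklore] -/
theorem prime_algebraMap_X_blowupAlgebra :
    Prime (algebraMap (MvPolynomial σ S)
      (blowupAlgebra (Ideal.span (X '' A)) (X i₀ : MvPolynomial σ S)) (X i₀)) := by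
  rw [← coordBlowupChartEquiv_X_self]
  exact (MulEquiv.prime_iff (coordBlowupChartEquiv S A i₀)).mpr (prime_X_of_isDomain S i₀)

omit [IsDomain S] in
/-- The ideal `(f_𝔙)` read in the chart ring is the image of `(f_𝔙) ⊆ S[X_σ]`. [folklore] -/
theorem span_coordBlowupChartEquiv_eq_map (g : MvPolynomial σ S) :
    Ideal.span {coordBlowupChartEquiv S A i₀ g} =
      (Ideal.span {g}).map
        ((coordBlowupChartEquiv S A i₀).toRingEquiv : MvPolynomial σ S →+*
          blowupAlgebra (Ideal.span (X '' A)) (X i₀ : MvPolynomial σ S)) := by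
  rw [Ideal.map_span, Set.image_singleton]
  rfl

/-- **The kernel of `S[X_σ][I/X_{i₀}] → (S[X_σ]/(f))[Ī/X̄_{i₀}]` is `(f_𝔙)`** (read through the
chart isomorphism): Görtz–Wedhorn Prop. 13.96 (2) for the hypersurface `V(f) ⊂ 𝔸^σ_S` and the
coordinate centre `V(X_i : i ∈ A)`, with Hu's proper transform as the strict transform of the
equation. [cite: GortzWedhorn2020, Prop. 13.96 (2) and p. 416] [cite: Hu2025, §5 Def. 5.4] -/
theorem ker_mapQuotient_eq_span_coordProperTransform (hi₀ : i₀ ∈ A) {f : MvPolynomial σ S}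
    (hf : f ≠ 0) :
    RingHom.ker (blowupAlgebra.mapQuotient (Ideal.span (X '' A)) (X i₀ : MvPolynomial σ S)
        (Ideal.span {f})) =
      Ideal.span {coordBlowupChartEquiv S A i₀ (coordProperTransform S A i₀ f)} :=
  blowupAlgebra.ker_mapQuotient_eq_span _ _
    (algebraMap_eq_pow_mul_coordBlowupChartEquiv_coordProperTransform S A i₀ hi₀ f)
    (prime_algebraMap_X_blowupAlgebra S A i₀)
    (not_dvd_coordBlowupChartEquiv_coordProperTransform S A i₀ hi₀ hf)

/-- **The chart over `X_{i₀}` of the blow-up of the hypersurface `V(f) ⊂ 𝔸^σ_S` (`f ≠ 0`, `S` a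
domain) along `V(X_i : i ∈ A)` is `Spec S[X_σ]/(f_𝔙)`**:
`S[X_σ]/(f_𝔙) ≅ (S[X_σ]/(f))[Ī/X̄_{i₀}]`, the affine blowup algebra of the hypersurface ring
— Hu's use of the proper transform `B_𝔙` as the local equation of the proper transform of
`(B = 0)` on the standard chart, justified by Görtz–Wedhorn Prop. 13.96 (2).
[cite: Hu2025, §5 Def. 5.4] [cite: GortzWedhorn2020, Prop. 13.96 (2) and p. 416] -/
def quotientCoordProperTransformEquiv (hi₀ : i₀ ∈ A) {f : MvPolynomial σ S} (hf : f ≠ 0) :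
    (MvPolynomial σ S ⧸ Ideal.span {coordProperTransform S A i₀ f}) ≃+*
      blowupAlgebra ((Ideal.span (X '' A)).map (Ideal.Quotient.mk (Ideal.span {f})))
        (Ideal.Quotient.mk (Ideal.span {f}) (X i₀ : MvPolynomial σ S)) :=
  (Ideal.quotientEquiv (Ideal.span {coordProperTransform S A i₀ f})
      (Ideal.span {coordBlowupChartEquiv S A i₀ (coordProperTransform S A i₀ f)})
      (coordBlowupChartEquiv S A i₀).toRingEquiv
      (span_coordBlowupChartEquiv_eq_map S A i₀ _)).trans
    (blowupAlgebra.quotientKerMapQuotientEquiv (Ideal.span (X '' A)) (X i₀ : MvPolynomial σ S)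
      (algebraMap_eq_pow_mul_coordBlowupChartEquiv_coordProperTransform S A i₀ hi₀ f)
      (prime_algebraMap_X_blowupAlgebra S A i₀)
      (not_dvd_coordBlowupChartEquiv_coordProperTransform S A i₀ hi₀ hf))

/-- The isomorphism on classes: `[p] ↦ (chart iso of p) mod (f)`, i.e. it is induced by the chart
map `X_i ↦ X_i/X_{i₀}` (`i ∈ A ∖ {i₀}`). [folklore] -/
theorem quotientCoordProperTransformEquiv_mk (hi₀ : i₀ ∈ A) {f : MvPolynomial σ S} (hf : f ≠ 0)
    (p : MvPolynomial σ S) :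
    quotientCoordProperTransformEquiv S A i₀ hi₀ hf (Ideal.Quotient.mk _ p) =
      blowupAlgebra.mapQuotient (Ideal.span (X '' A)) (X i₀ : MvPolynomial σ S) (Ideal.span {f})
        (coordBlowupChartEquiv S A i₀ p) :=
  rfl

end Literature.AlgebraicGeometry.Resolution

end
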